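import Summits.ValiantsHypothesis.ValiantsHypothesis.Theorems.LacunarySymmetroidMatrixDescartesCensusDoorBFarTop

/-!
# `MatrixDescartes` census — THEOREM U above κ*: the `(2,3)` word law `D I I` as a kernel theorem about pencils

HONEST FRAMING.  Object-search cell `pub-symmetroid`, route crux `Theses.LacunarySymmetroid.MatrixDescartes`
(ledger item stmt-ValiantsHypothesis-18050).  engine-1 g13's THEOREM U (DOORB-GRAM §2, reader PASS theory-3 g12,
R883) says: if `det(S₀ + x^{d₁}S₁ + x^{d₂}S₂)` (`S_i` real symmetric `2 × 2`, `0 < d₁ < d₂`, `d₂ ≠ 2d₁`) has `5`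
distinct positive roots, then the word is `D I I` for `d₂ < 2d₁` and `I I D` for `d₂ > 2d₁`.  Its proof uses the
bracket identity / five-point conics.  This file puts the NEWTON-REACHABLE part into the kernel, with no conics:
for `d₂ < 2d₁` AND `5d₂² ≥ 5d₁d₂ + d₁²` (i.e. `d₂/d₁ ≥ κ* = (5+3√5)/10`, engine-1 g14's PROPOSITION κ*; e.g. every
`d₂ = d₁ + 1` with `d₁ ≤ 5`), every such pencil with `≥ 5` distinct positive determinant roots has
`det S₀ > 0`, `det S₁ < 0`, `det S₂ < 0`.  Route: the six knots `(0,d₁,d₂,2d₁,d₁+d₂,2d₂)` ARE the whole pair-sum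
set, the bridge `Census.doorB_window_of_newtonGood` (…CensusDoorBBridge.lean) applies with its Newton hypothesis
equal to `M^{low} ≥ 0`, which is `Census.kappaStar_identity`'s `36 d₁⁸d₂⁵(d₂−d₁)⁵(5d₂²−5d₁d₂−d₁²) ≥ 0`.
The κ-corner `d₂/d₁ < κ*` of THEOREM U (where Newton is silent) and the `d₂ > 2d₁` half are NOT covered here.

* `six_strictMono`, `six_image`, `six_sq_uncollided`, `six_pair_uncollided` — bookkeeping for `d = (0,d₁,d₂)`.
* **`wordLaw_2_3_of_kappa`** — the theorem.

Nothing here bears on `ζ_sym`, `DoorA26` / `DoorA34` (OPEN), the crux `MatrixDescartes` or `VP ≠ VNP`.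
[folklore] — elementary; THEOREM U is the cell's (engine-1 g13), this Newton-side proof engine-1 g15's.
-/

-- `Summit.ValiantsHypothesis.ValiantsHypothesis.…` repeats a component by the D-0017 layout
-- (single-conjunct summit), which the `dupNamespace` linter flags; the name is mandated.
set_option linter.dupNamespace false

namespace Summit.ValiantsHypothesis.ValiantsHypothesis.Theorems.LacunarySymmetroidMatrixDescartes.Census

open Polynomial Finset
open scoped BigOperators Polynomial Matrix

/-- The three entries of `![0, d₁, d₂]` at `Fin.mk` literals (for `simp` after `fin_cases`). [folklore] -/
theorem vec3_mk_vals (d₁ d₂ : ℕ) :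
    (∀ h, (![0, d₁, d₂] : Fin 3 → ℕ) ⟨0, h⟩ = 0) ∧ (∀ h, (![0, d₁, d₂] : Fin 3 → ℕ) ⟨1, h⟩ = d₁) ∧
    (∀ h, (![0, d₁, d₂] : Fin 3 → ℕ) ⟨2, h⟩ = d₂) :=
  ⟨fun _ => rfl, fun _ => rfl, fun _ => rfl⟩

/-- On a class-G `(2,3)` support `(0,d₁,d₂)` (`d₁ < d₂ < 2d₁`) every square knot `2d_i` is uncollided. [folklore] -/
theorem six_sq_uncollided (d₁ d₂ : ℕ) (h12 : d₁ < d₂) (h21 : d₂ < 2 * d₁) (i : Fin 3) (p : Fin 3 × Fin 3)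
    (h : (![0, d₁, d₂] : Fin 3 → ℕ) p.1 + (![0, d₁, d₂] : Fin 3 → ℕ) p.2
      = (![0, d₁, d₂] : Fin 3 → ℕ) i + (![0, d₁, d₂] : Fin 3 → ℕ) i) : p = (i, i) := by
  obtain ⟨v0, v1, v2⟩ := vec3_mk_vals d₁ d₂
  obtain ⟨x, y⟩ := p
  fin_cases i <;> fin_cases x <;> fin_cases y <;>
    first | rfl | (exfalso; simp only [v0, v1, v2] at h; omega)

/-- On a class-G `(2,3)` support the three pair knots `d₁`, `d₂`, `d₁+d₂` are uncollided. [folklore] -/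
theorem six_pair_uncollided (d₁ d₂ : ℕ) (h12 : d₁ < d₂) (h21 : d₂ < 2 * d₁) :
    (∀ p : Fin 3 × Fin 3, (![0, d₁, d₂] : Fin 3 → ℕ) p.1 + (![0, d₁, d₂] : Fin 3 → ℕ) p.2
        = (![0, d₁, d₂] : Fin 3 → ℕ) 0 + (![0, d₁, d₂] : Fin 3 → ℕ) 1 → p = (0, 1) ∨ p = (1, 0)) ∧
    (∀ p : Fin 3 × Fin 3, (![0, d₁, d₂] : Fin 3 → ℕ) p.1 + (![0, d₁, d₂] : Fin 3 → ℕ) p.2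
        = (![0, d₁, d₂] : Fin 3 → ℕ) 0 + (![0, d₁, d₂] : Fin 3 → ℕ) 2 → p = (0, 2) ∨ p = (2, 0)) ∧
    (∀ p : Fin 3 × Fin 3, (![0, d₁, d₂] : Fin 3 → ℕ) p.1 + (![0, d₁, d₂] : Fin 3 → ℕ) p.2
        = (![0, d₁, d₂] : Fin 3 → ℕ) 1 + (![0, d₁, d₂] : Fin 3 → ℕ) 2 → p = (1, 2) ∨ p = (2, 1)) := by
  obtain ⟨v0, v1, v2⟩ := vec3_mk_vals d₁ d₂
  have n0 : (![0, d₁, d₂] : Fin 3 → ℕ) 0 = 0 := rfl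
  have n1 : (![0, d₁, d₂] : Fin 3 → ℕ) 1 = d₁ := rfl
  have n2 : (![0, d₁, d₂] : Fin 3 → ℕ) 2 = d₂ := rfl
  refine ⟨?_, ?_, ?_⟩ <;> rintro ⟨x, y⟩ h <;> fin_cases x <;> fin_cases y <;>
    first | decide | (exfalso; simp only [v0, v1, v2, n0, n1, n2] at h; omega)

/-- The six pair sums of a class-G `(2,3)` support, listed as `(0, d₁, d₂, 2d₁, d₁+d₂, 2d₂)`, are strictly
increasing. [folklore] -/
theorem six_strictMono (d₁ d₂ : ℕ) (h12 : d₁ < d₂) (h21 : d₂ < 2 * d₁) :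
    StrictMono (![0, d₁, d₂, 2 * d₁, d₁ + d₂, 2 * d₂] : Fin 6 → ℕ) := by
  refine Fin.strictMono_iff_lt_succ.mpr ?_
  intro i
  fin_cases i
  · show 0 < d₁; omega
  · show d₁ < d₂; omega
  · show d₂ < 2 * d₁; omega
  · show 2 * d₁ < d₁ + d₂; omega
  · show d₁ + d₂ < 2 * d₂; omega

/-- On a `(2,3)` support the set of pair sums is the image of the knot list `(0, d₁, d₂, 2d₁, d₁+d₂, 2d₂)`.
[folklore] -/
theorem six_image (d₁ d₂ : ℕ) :
    (Finset.univ : Finset (Fin 6)).image (![0, d₁, d₂, 2 * d₁, d₁ + d₂, 2 * d₂] : Fin 6 → ℕ)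
      = (Finset.univ : Finset (Fin 3 × Fin 3)).image
          (fun p => (![0, d₁, d₂] : Fin 3 → ℕ) p.1 + (![0, d₁, d₂] : Fin 3 → ℕ) p.2) := by
  set d : Fin 3 → ℕ := ![0, d₁, d₂] with hd_def
  set E : Fin 6 → ℕ := ![0, d₁, d₂, 2 * d₁, d₁ + d₂, 2 * d₂] with hE_def
  set W := (Finset.univ : Finset (Fin 3 × Fin 3)).image (fun p => d p.1 + d p.2) with hW_def
  have memW : ∀ x y : Fin 3, d x + d y ∈ W := fun x y =>
    Finset.mem_image.mpr ⟨(x, y), Finset.mem_univ _, rfl⟩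
  have memW' : ∀ x y : Fin 3, ∀ v : ℕ, v = d x + d y → v ∈ W := fun x y v hv => hv ▸ memW x y
  have hEW : ∀ i, E i ∈ W := by
    intro i
    fin_cases i
    · exact memW' 0 0 _ (by show 0 = 0 + 0; rfl)
    · exact memW' 0 1 _ (by show d₁ = 0 + d₁; omega)
    · exact memW' 0 2 _ (by show d₂ = 0 + d₂; omega)
    · exact memW' 1 1 _ (by show 2 * d₁ = d₁ + d₁; omega)
    · exact memW' 1 2 _ (by show d₁ + d₂ = d₁ + d₂; rfl)
    · exact memW' 2 2 _ (by show 2 * d₂ = d₂ + d₂; omega)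
  have hWE : ∀ x y : Fin 3, ∃ i, E i = d x + d y := by
    intro x y
    fin_cases x <;> fin_cases y
    · exact ⟨0, by show 0 = 0 + 0; rfl⟩
    · exact ⟨1, by show d₁ = 0 + d₁; omega⟩
    · exact ⟨2, by show d₂ = 0 + d₂; omega⟩
    · exact ⟨1, by show d₁ = d₁ + 0; omega⟩
    · exact ⟨3, by show 2 * d₁ = d₁ + d₁; omega⟩
    · exact ⟨4, by show d₁ + d₂ = d₁ + d₂; rfl⟩
    · exact ⟨2, by show d₂ = d₂ + 0; omega⟩
    · exact ⟨4, by show d₁ + d₂ = d₂ + d₁; omega⟩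
    · exact ⟨5, by show 2 * d₂ = d₂ + d₂; omega⟩
  ext x
  constructor
  · intro hx
    obtain ⟨i, -, rfl⟩ := Finset.mem_image.mp hx
    exact hEW i
  · intro hx
    obtain ⟨⟨a, b⟩, -, rfl⟩ := Finset.mem_image.mp hx
    obtain ⟨i, hi⟩ := hWE a b
    exact Finset.mem_image.mpr ⟨i, Finset.mem_univ _, hi⟩

set_option maxHeartbeats 400000 in
/-- **THEOREM U above κ* (kernel): the `(2,3)` word law `D I I`.**  Let `d₁ < d₂ < 2d₁` with
`5d₁d₂ + d₁² ≤ 5d₂²` (`d₂/d₁ ≥ κ* = (5+3√5)/10`; all `(d₁, d₁+1)` with `d₁ ≤ 5`, all `d₂/d₁ ≥ 1.171`).  Then every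
real symmetric `2 × 2` pencil `S₀ + x^{d₁}S₁ + x^{d₂}S₂` whose determinant has at least `5 = D(2,3)` distinct
positive roots has `det S₀ > 0`, `det S₁ < 0`, `det S₂ < 0` — word `D I I`, as engine-1 g13's THEOREM U states for
every `d₂ < 2d₁` (the part `d₂/d₁ < κ*` of THEOREM U is not reachable by the Newton cone and is not claimed here).
Proof: `Census.doorB_window_of_newtonGood` at `K = 3` (the six knots are the whole support), its Newton hypothesis
being PROPOSITION κ* (`36 d₁⁸d₂⁵(d₂−d₁)⁵(5d₂²−5d₁d₂−d₁²) ≥ 0`, here re-derived by `ring`/`linarith` over `ℤ`).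
[folklore] -/
theorem wordLaw_2_3_of_kappa (d₁ d₂ : ℕ) (h12 : d₁ < d₂) (h21 : d₂ < 2 * d₁)
    (hκ : 5 * d₁ * d₂ + d₁ ^ 2 ≤ 5 * d₂ ^ 2)
    (S : Fin 3 → Matrix (Fin 2) (Fin 2) ℝ) (hS : ∀ l, (S l).IsSymm)
    (h5 : 5 ≤ ((∑ l, ((X : ℝ[X]) ^ (![0, d₁, d₂] : Fin 3 → ℕ) l) • (S l).map C).det.roots.toFinset.filter
      (fun t => 0 < t)).card) :
    0 < (S 0).det ∧ (S 1).det < 0 ∧ (S 2).det < 0 := by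
  classical
  have h1 : 0 < d₁ := by omega
  set d : Fin 3 → ℕ := ![0, d₁, d₂] with hd_def
  set E : Fin 6 → ℕ := ![0, d₁, d₂, 2 * d₁, d₁ + d₂, 2 * d₂] with hE_def
  have hE : StrictMono E := six_strictMono d₁ d₂ h12 h21
  set W := (Finset.univ : Finset (Fin 3 × Fin 3)).image (fun p => d p.1 + d p.2) with hW_def
  have himage : Finset.univ.image E = W := six_image d₁ d₂
  have hEW : ∀ i, E i ∈ W := fun i => himage ▸ Finset.mem_image_of_mem _ (Finset.mem_univ i)
  have hcard : W.card = 6 := by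
    rw [← himage, Finset.card_image_of_injective _ hE.injective]; simp
  have hEeq : (E : Fin 6 → ℕ) = W.orderEmbOfFin hcard := Finset.orderEmbOfFin_unique hcard hEW hE
  have hrank : ∀ k : Fin 6, (W.filter (· < E k)).card = k := by
    intro k
    have := card_filter_lt_orderEmbOfFin W hcard k
    rwa [← hEeq] at this
  have usq : ∀ i : Fin 3, ∀ p : Fin 3 × Fin 3, d p.1 + d p.2 = d i + d i → p = (i, i) :=
    fun i p hp => six_sq_uncollided d₁ d₂ h12 h21 i p hp
  obtain ⟨u01, u02, u12⟩ := six_pair_uncollided d₁ d₂ h12 h21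
  have k00 : d 0 + d 0 = E 0 := rfl
  have k01 : d 0 + d 1 = E 1 := by show 0 + d₁ = d₁; omega
  have k02 : d 0 + d 2 = E 2 := by show 0 + d₂ = d₂; omega
  have k11 : d 1 + d 1 = E 3 := by show d₁ + d₁ = 2 * d₁; omega
  have k12 : d 1 + d 2 = E 4 := rfl
  have k22 : d 2 + d 2 = E 5 := by show d₂ + d₂ = 2 * d₂; omega
  have hr0 : (W.filter (· < d 0 + d 0)).card = 0 := by rw [k00]; exact hrank 0
  have hr1 : (W.filter (· < d 0 + d 1)).card = 1 := by rw [k01]; exact hrank 1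
  have hr2 : (W.filter (· < d 0 + d 2)).card = 2 := by rw [k02]; exact hrank 2
  have hr3 : (W.filter (· < d 1 + d 1)).card = 3 := by rw [k11]; exact hrank 3
  have hr4 : (W.filter (· < d 1 + d 2)).card = 4 := by rw [k12]; exact hrank 4
  have hr5 : (W.filter (· < d 2 + d 2)).card = 5 := by rw [k22]; exact hrank 5
  -- the Newton condition `M^{low} ≥ 0` = PROPOSITION κ*, over `ℤ`
  have hconv : ∀ k : Fin 6, (∏ u ∈ W.erase (E k), ((Nat.dist (E k) u : ℕ) : ℤ))
      = ∏ j ∈ univ.erase k, |(E k : ℤ) - E j| := by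
    intro k
    rw [← himage, ← Finset.image_erase hE.injective, Finset.prod_image hE.injective.injOn]
    exact Finset.prod_congr rfl fun u _ => intCast_natDist _ _
  have z12 : (d₁ : ℤ) < d₂ := by exact_mod_cast h12
  have z21 : (d₂ : ℤ) < 2 * d₁ := by exact_mod_cast h21
  have z1 : (0 : ℤ) < d₁ := by exact_mod_cast h1
  have zκ : 5 * (d₁ : ℤ) * d₂ + (d₁ : ℤ) ^ 2 ≤ 5 * (d₂ : ℤ) ^ 2 := by exact_mod_cast hκ
  have hMZ : (∏ j ∈ univ.erase (0 : Fin 6), |(E 0 : ℤ) - E j|) * (∏ j ∈ univ.erase (2 : Fin 6), |(E 2 : ℤ) - E j|)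
          * (∏ j ∈ univ.erase (3 : Fin 6), |(E 3 : ℤ) - E j|) * (∏ j ∈ univ.erase (4 : Fin 6), |(E 4 : ℤ) - E j|)
        + (∏ j ∈ univ.erase (1 : Fin 6), |(E 1 : ℤ) - E j|) * (∏ j ∈ univ.erase (2 : Fin 6), |(E 2 : ℤ) - E j|) ^ 2
          * (∏ j ∈ univ.erase (3 : Fin 6), |(E 3 : ℤ) - E j|)
      ≤ (∏ j ∈ univ.erase (0 : Fin 6), |(E 0 : ℤ) - E j|) * (∏ j ∈ univ.erase (1 : Fin 6), |(E 1 : ℤ) - E j|)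
          * (∏ j ∈ univ.erase (4 : Fin 6), |(E 4 : ℤ) - E j|) ^ 2 := by
    simp only [prod_univ_erase_eq_prod_ite_int, hE_def]
    simp [Fin.prod_univ_succ]
    simp (disch := omega) only [abs_of_nonpos, abs_of_nonneg]
    have ha : (0 : ℤ) ≤ (d₂ : ℤ) - d₁ := by linarith
    have hb : (0 : ℤ) ≤ 5 * (d₂ : ℤ) ^ 2 - 5 * d₁ * d₂ - (d₁ : ℤ) ^ 2 := by linarith
    have hc : (0 : ℤ) ≤ (d₂ : ℤ) := by linarith
    have hk : (0 : ℤ) ≤ 36 * (d₁ : ℤ) ^ 8 * (d₂ : ℤ) ^ 5 * ((d₂ : ℤ) - d₁) ^ 5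
        * (5 * (d₂ : ℤ) ^ 2 - 5 * d₁ * d₂ - (d₁ : ℤ) ^ 2) :=
      mul_nonneg (mul_nonneg (mul_nonneg (mul_nonneg (by norm_num) (pow_nonneg z1.le 8)) (pow_nonneg hc 5))
        (pow_nonneg ha 5)) hb
    rw [← sub_nonneg]
    ring_nf
    ring_nf at hk
    linarith
  have hMW : (∏ u ∈ W.erase (d 0 + d 0), Nat.dist (d 0 + d 0) u) * (∏ u ∈ W.erase (d 0 + d 2), Nat.dist (d 0 + d 2) u)
          * (∏ u ∈ W.erase (d 1 + d 1), Nat.dist (d 1 + d 1) u) * (∏ u ∈ W.erase (d 1 + d 2), Nat.dist (d 1 + d 2) u)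
        + (∏ u ∈ W.erase (d 0 + d 1), Nat.dist (d 0 + d 1) u) * (∏ u ∈ W.erase (d 0 + d 2), Nat.dist (d 0 + d 2) u) ^ 2
          * (∏ u ∈ W.erase (d 1 + d 1), Nat.dist (d 1 + d 1) u)
      ≤ (∏ u ∈ W.erase (d 0 + d 0), Nat.dist (d 0 + d 0) u) * (∏ u ∈ W.erase (d 0 + d 1), Nat.dist (d 0 + d 1) u)
          * (∏ u ∈ W.erase (d 1 + d 2), Nat.dist (d 1 + d 2) u) ^ 2 := by
    rw [k00, k01, k02, k11, k12]
    have h : (((∏ u ∈ W.erase (E 0), Nat.dist (E 0) u) * (∏ u ∈ W.erase (E 2), Nat.dist (E 2) u)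
          * (∏ u ∈ W.erase (E 3), Nat.dist (E 3) u) * (∏ u ∈ W.erase (E 4), Nat.dist (E 4) u)
        + (∏ u ∈ W.erase (E 1), Nat.dist (E 1) u) * (∏ u ∈ W.erase (E 2), Nat.dist (E 2) u) ^ 2
          * (∏ u ∈ W.erase (E 3), Nat.dist (E 3) u) : ℕ) : ℤ)
      ≤ (((∏ u ∈ W.erase (E 0), Nat.dist (E 0) u) * (∏ u ∈ W.erase (E 1), Nat.dist (E 1) u)
          * (∏ u ∈ W.erase (E 4), Nat.dist (E 4) u) ^ 2 : ℕ) : ℤ) := by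
      push_cast
      rw [hconv 0, hconv 1, hconv 2, hconv 3, hconv 4]
      exact hMZ
    exact_mod_cast h
  obtain ⟨-, hletter⟩ := doorB_window_of_newtonGood d 0 1 2 (by decide) (by decide) (by decide)
    (usq 0) (usq 1) (usq 2) u01 u02 u12 ⟨hr0, hr1, hr2, hr3, hr4, hr5⟩ hMW S hS
    (by rw [hcard]; exact Nat.succ_le_succ h5)
  have s0 := hletter 0 (usq 0)
  have s1 := hletter 1 (usq 1)
  have s2 := hletter 2 (usq 2)
  rw [hr0] at s0
  rw [hr3] at s1
  rw [hr5] at s2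
  norm_num at s0 s1 s2
  exact ⟨by linarith, by linarith, by linarith⟩

end Summit.ValiantsHypothesis.ValiantsHypothesis.Theorems.LacunarySymmetroidMatrixDescartes.Census
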